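import Summits.ResolutionOfSingularities.ResolutionOfSingularities.Theorems.HilbertSamuelEliminationSigmaMaxModificationsCorridor3HypersurfacePoints
import Literature.AlgebraicGeometry.Resolution.MarkedIdeals
import HarnessLib

/-!
# Route `HilbertSamuelElimination`, crux `SigmaMaxModificationsCorridor3`
# (stmt-ResolutionOfSingularities-19249; child of `SigmaMaxModifications` stmt-…-18506),
# line `tame_wild`: the order and the support of a marked ideal with PRINCIPAL stalks, read
# against the Hilbert–Samuel stratum of a tame value (input of H5)

[OURS · L1 W4.2] The marked-ideal side of the bookkeeping of `…Corridor3HypersurfacePoints.lean`,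
for the lead's H5 (`TameArchitecture.lean`: `stub_tameNu3_of_embedded`, hypothesis `hord` of
`TameHypersurfaceOrderReduction₄`: "`ord_z 𝓘 ≤ m` everywhere", and "`supp(𝓘, m) = Y(ν)` locally").
NOT a statement of any manuscript.

* `idealOrder_eq_natCast_iff` — `ord_x(I) = m ↔ I_x ⊆ 𝔪_x^m ∧ I_x ⊄ 𝔪_x^{m+1}` (BGMW §3.1);
  `idealOrder_eq_of_stalkIdeal_eq_span_singleton` — for a principal stalk `I_x = (g)` with
  `g ∈ 𝔪^m ∖ 𝔪^{m+1}`: `ord_x(I) = m`;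
  `mem_support_iff_mult_le_of_stalkIdeal_eq_span_singleton` — `x ∈ supp(𝓘, μ) ↔ μ ≤ m`.
* **`idealOrder_le_and_mem_support_iff_of_maximal`** — the pointwise content of `hord` and of
  `supp(𝓘_Y, m) = Y(ν)`: let `ν = hypersurfaceHFe (N+1) m` be a MAXIMAL value of `Σ_Y(N)`; at a
  point `z` of a scheme `Z` with regular local ring of dimension `e ≤ N + 1`, suppose the stalk of the
  ideal sheaf `𝓘` is principal, `𝓘_z = (g)` with `g ∈ 𝔪^{m'} ∖ 𝔪^{m'+1}`, `m' ≥ 1`, and suppose a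
  point `y` of `Y` has `𝒪_{Y,y} ≅ 𝒪_{Z,z}/(g)` (the situation of a closed immersion `Y ∩ U ↪ Z` of a
  hypersurface, `z = y`). Then `ord_z(𝓘) ≤ m`, and `z ∈ supp(𝓘, m) ↔ y ∈ Y(ν)`.

## Sources

* E. Bierstone, D. Grigoriev, P. Milman, J. Włodarczyk, *Effective Hironaka resolution and its
  complexity*, Asian J. Math. 15 (2011), §3.1 (order, support of a marked ideal).
  [BierstoneGrigorievMilmanWlodarczyk2011]
* V. Cossart, U. Jannsen, S. Saito, LNM 2270 (2020), Def. 2.28, Def. 2.35, Thm. 2.3.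
  [CossartJannsenSaito2020]
-/

set_option linter.dupNamespace false -- mandated namespace of this single-conjunct summit

noncomputable section

open IsLocalRing AlgebraicGeometry
open Literature.RingTheory.HilbertSamuel Literature.AlgebraicGeometry.Resolution
open Summit.ResolutionOfSingularities.ResolutionOfSingularities.Theorems.SigmaMaxModificationsCorridor3.TameWild

namespace Summit.ResolutionOfSingularities.ResolutionOfSingularities.Theorems.SigmaMaxModificationsCorridor3.Helpers

universe u v

/-! ## The order of an ideal sheaf with principal stalk -/

section Order

variable {X : Scheme.{u}}

/-- **`ord_x(I) = m ↔ I_x ⊆ 𝔪_x^m ∧ I_x ⊄ 𝔪_x^{m+1}`.**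
[cite: BierstoneGrigorievMilmanWlodarczyk2011, §3.1 p. 6] -/
theorem idealOrder_eq_natCast_iff (I : X.IdealSheafData) (x : X) (m : ℕ) :
    idealOrder I x = m ↔
      stalkIdeal I x ≤ maximalIdeal (X.presheaf.stalk x) ^ m ∧
        ¬ stalkIdeal I x ≤ maximalIdeal (X.presheaf.stalk x) ^ (m + 1) := by
  constructor
  · intro h
    refine ⟨(le_idealOrder_iff I x m).mp h.ge, fun hle => ?_⟩
    have h1 : ((m + 1 : ℕ) : ℕ∞) ≤ idealOrder I x := (le_idealOrder_iff I x (m + 1)).mpr hle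
    rw [h] at h1
    have h2 : m + 1 ≤ m := by exact_mod_cast h1
    omega
  · rintro ⟨hm, hm'⟩
    refine le_antisymm ?_ ((le_idealOrder_iff I x m).mpr hm)
    by_contra hlt
    rw [not_le] at hlt
    have h1 : ((m + 1 : ℕ) : ℕ∞) ≤ idealOrder I x := by
      push_cast
      exact ENat.coe_add_one_le_iff.mpr hlt
    exact hm' ((le_idealOrder_iff I x (m + 1)).mp h1)

/-- **A principal stalk `I_x = (g)` with `g ∈ 𝔪^m ∖ 𝔪^{m+1}` has `ord_x(I) = m`.**
[cite: BierstoneGrigorievMilmanWlodarczyk2011, §3.1 p. 6] -/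
theorem idealOrder_eq_of_stalkIdeal_eq_span_singleton (I : X.IdealSheafData) {x : X}
    {g : X.presheaf.stalk x} {m : ℕ} (hI : stalkIdeal I x = Ideal.span {g})
    (hgm : g ∈ maximalIdeal (X.presheaf.stalk x) ^ m)
    (hgm' : g ∉ maximalIdeal (X.presheaf.stalk x) ^ (m + 1)) : idealOrder I x = m := by
  rw [idealOrder_eq_natCast_iff, hI, Ideal.span_singleton_le_iff_mem, Ideal.span_singleton_le_iff_mem]
  exact ⟨hgm, hgm'⟩

/-- An element of order exactly `m` lies in `𝔪^μ` iff `μ ≤ m`. [folklore] -/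
theorem mem_pow_iff_le_of_mem_pow_of_not_mem_pow_succ {A : Type v} [CommRing A] [IsLocalRing A]
    {g : A} {m : ℕ} (hgm : g ∈ maximalIdeal A ^ m) (hgm' : g ∉ maximalIdeal A ^ (m + 1)) (μ : ℕ) :
    g ∈ maximalIdeal A ^ μ ↔ μ ≤ m := by
  refine ⟨fun h => ?_, fun h => Ideal.pow_le_pow_right h hgm⟩
  by_contra hlt
  exact hgm' (Ideal.pow_le_pow_right (by omega) h)

/-- **Support membership for a principal stalk**: if `𝓘_x = (g)` with `g ∈ 𝔪^m ∖ 𝔪^{m+1}`, then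
`x ∈ supp(𝓘, E, μ) ↔ μ ≤ m`. [cite: BierstoneGrigorievMilmanWlodarczyk2011, Def. 3.1.2] -/
theorem mem_support_iff_mult_le_of_stalkIdeal_eq_span_singleton (M : MarkedIdeal X) {x : X}
    {g : X.presheaf.stalk x} {m : ℕ} (hI : stalkIdeal M.ideal x = Ideal.span {g})
    (hgm : g ∈ maximalIdeal (X.presheaf.stalk x) ^ m)
    (hgm' : g ∉ maximalIdeal (X.presheaf.stalk x) ^ (m + 1)) : x ∈ M.support ↔ M.mult ≤ m := by
  rw [MarkedIdeal.mem_support_iff, hI, Ideal.span_singleton_le_iff_mem]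
  exact mem_pow_iff_le_of_mem_pow_of_not_mem_pow_succ hgm hgm' M.mult

end Order

/-! ## Reading against the stratum of a maximal tame value -/

section Maximal

variable {Y : Scheme.{u}} {Z : Scheme.{u}} {N m : ℕ}

/-- **`ord ≤ m` and `supp(𝓘, m) = Y(ν)`, pointwise.** Let `ν = hypersurfaceHFe (N+1) m` be maximal in
`Σ_Y(N)`. Let `z ∈ Z` have a regular local ring of dimension `e ≤ N + 1`, let the stalk of the ideal
sheaf of the marked ideal `M = (𝓘, E, m)` at `z` be principal, `𝓘_z = (g)` with
`g ∈ 𝔪^{m'} ∖ 𝔪^{m'+1}`, `m' ≥ 1`, and let `y ∈ Y` have `𝒪_{Y,y} ≅ 𝒪_{Z,z}/(g)` (a hypersurface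
point of `Z` lying on `Y`; for a closed immersion `Y ∩ U ↪ Z`, `z = y`). Then `ord_z(𝓘) = m' ≤ m`, and
`z ∈ supp(M) ↔ y ∈ Y(ν)`. [cite: CossartJannsenSaito2020, Def. 2.28, Def. 2.35, Thm. 2.3]
[cite: BierstoneGrigorievMilmanWlodarczyk2011, Def. 3.1.2] -/
theorem idealOrder_le_and_mem_support_iff_of_maximal
    (hν : Maximal (· ∈ Scheme.hsValues Y N) (hypersurfaceHFe (N + 1) m)) (M : MarkedIdeal Z)
    (hM : M.mult = m) {z : Z} [IsRegularLocalRing (Z.presheaf.stalk z)] {e m' : ℕ}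
    (he : ringKrullDim (Z.presheaf.stalk z) = e) (heN : e ≤ N + 1) (hm' : 1 ≤ m')
    {g : Z.presheaf.stalk z} (hI : stalkIdeal M.ideal z = Ideal.span {g})
    (hgm : g ∈ maximalIdeal (Z.presheaf.stalk z) ^ m')
    (hgm' : g ∉ maximalIdeal (Z.presheaf.stalk z) ^ (m' + 1)) {y : Y}
    (ε : Y.presheaf.stalk y ≃+* Z.presheaf.stalk z ⧸ Ideal.span {g}) :
    idealOrder M.ideal z ≤ m ∧ (z ∈ M.support ↔ y ∈ Scheme.hsStratum Y N (hypersurfaceHFe (N + 1) m)) := by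
  obtain ⟨hle, hiff⟩ := mult_le_and_mem_hsStratum_iff_of_stalk_ringEquiv hν he heN hm' hgm hgm' ε
  refine ⟨?_, ?_⟩
  · rw [idealOrder_eq_of_stalkIdeal_eq_span_singleton M.ideal hI hgm hgm']
    exact_mod_cast hle
  · rw [mem_support_iff_mult_le_of_stalkIdeal_eq_span_singleton M hI hgm hgm', hM, hiff]
    omega

end Maximal

end Summit.ResolutionOfSingularities.ResolutionOfSingularities.Theorems.SigmaMaxModificationsCorridor3.Helpers

end
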